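import Literature.AnabelianGeometry.SemiGraphs.OrbitGraph
import Literature.AnabelianGeometry.SemiGraphs.UniversalCovering
import Literature.AnabelianGeometry.SemiGraphs.FundamentalGroupoidCountable

/-!
# The covering `𝒢_{∞,S} → 𝒢` over a covering `S` ([SemiAnbd] §3 p. 38) — fibres and actions

Mochizuki, *Semi-graphs of anabelioids*, §3 p. 38: "`𝒢_{∞,i} → 𝒢_i` for the covering of `𝒢_i`
determined by the universal graph-covering of the underlying semi-graph `𝔾_i` of `𝒢_i`. Thus, the
`𝒢_{∞,i} → 𝒢` are tempered coverings of `𝒢`".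

For an object `S` of `B^cov(𝒢)` (the covering `𝒢_S → 𝒢`, underlying semi-graph
`𝔾_S = S.orbitGraph`, `OrbitGraph.lean`) and a base component `c` of `𝔾_S`, the fibre of
`𝒢_{∞,S} → 𝒢` over a vertex `v` is the set of triples `(V, x, p)`: a vertex `V` of `𝔾_S` over `v`
(an orbit of `Π_v` on `S_v`), a point `x ∈ V ⊆ S_v`, and a homotopy class of paths `p : c ⟶ V` in
`𝔾_S` (a vertex of the universal graph-covering `𝔾̃_S` over `V`); `Π_v` acts through `x`.  This file
constructs these fibres as objects of `B^temp(Π_v)` / `B^temp(Π_e)` (`fibV`, `fibE`: countable with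
open stabilisers when `𝒢` is countable).  The gluing and the object of `B^cov(𝒢)` follow in the
sequel.
-/

namespace Literature.AnabelianGeometry.SemiGraphs

namespace ProfiniteSemiGraph

open CategoryTheory

universe u

variable {𝒢 : ProfiniteSemiGraph.{u}} (S : CovObj 𝒢) (c : S.orbitGraph.CatCarrier)

/-- The underlying set of the fibre of `𝒢_{∞,S}` over the vertex `v`: triples (orbit `V` over `v`,
point of `V`, path class `c ⟶ V` in `𝔾_S`). [cite: MochizukiSemiAnbd2006, Prop 3.6 p.38] -/
def CovObj.FibV (v : 𝒢.graph.Vertex) : Type u :=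
  Σ V : {V : S.OVertex // CovObj.OVertex.base S V = v},
    {x : (S.SV v).obj.V // Quot.mk _ ⟨v, x⟩ = V.1} ×
      (S.orbitGraph.basept c ⟶ S.orbitGraph.basept (Sum.inl V.1))

/-- The underlying set of the fibre of `𝒢_{∞,S}` over the edge `e`. [cite: MochizukiSemiAnbd2006, Prop 3.6 p.38] -/
def CovObj.FibE (e : 𝒢.graph.Edge) : Type u :=
  Σ E : {E : S.OEdge // CovObj.OEdge.base S E = e},
    {y : (S.SE e).obj.V // Quot.mk _ ⟨e, y⟩ = E.1} ×
      (S.orbitGraph.basept c ⟶ S.orbitGraph.basept (Sum.inr E.1))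

/-- The action of `Π_v` on the fibre over `v`: through the point (orbits and paths are fixed).
[cite: MochizukiSemiAnbd2006, Prop 3.6 p.38] -/
def CovObj.fibVAct (v : 𝒢.graph.Vertex) (g : 𝒢.Gv v) : S.FibV c v → S.FibV c v :=
  fun t => ⟨t.1, ⟨⟨(S.SV v).obj.ρ g t.2.1.1,
    (Quot.sound (CovObj.VRel.mk (S := S) v g t.2.1.1)).symm.trans t.2.1.2⟩, t.2.2⟩⟩

/-- The action of `Π_e` on the fibre over `e`. [cite: MochizukiSemiAnbd2006, Prop 3.6 p.38] -/
def CovObj.fibEAct (e : 𝒢.graph.Edge) (g : 𝒢.Ge e) : S.FibE c e → S.FibE c e :=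
  fun t => ⟨t.1, ⟨⟨(S.SE e).obj.ρ g t.2.1.1,
    (Quot.sound (CovObj.ERel.mk (S := S) e g t.2.1.1)).symm.trans t.2.1.2⟩, t.2.2⟩⟩

/-- Extensionality for points of the fibre over `v`: same orbit, same point, same path.
[cite: MochizukiSemiAnbd2006, Prop 3.6 p.38] -/
theorem CovObj.FibV.ext {v : 𝒢.graph.Vertex} {t t' : S.FibV c v} (h1 : t.1 = t'.1)
    (h2 : t.2.1.1 = t'.2.1.1) (h3 : HEq t.2.2 t'.2.2) : t = t' := by
  obtain ⟨V, ⟨x, hx⟩, p⟩ := t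
  obtain ⟨V', ⟨x', hx'⟩, p'⟩ := t'
  cases h1
  cases h2
  cases h3
  rfl

/-- Extensionality for points of the fibre over `e`. [cite: MochizukiSemiAnbd2006, Prop 3.6 p.38] -/
theorem CovObj.FibE.ext {e : 𝒢.graph.Edge} {t t' : S.FibE c e} (h1 : t.1 = t'.1)
    (h2 : t.2.1.1 = t'.2.1.1) (h3 : HEq t.2.2 t'.2.2) : t = t' := by
  obtain ⟨E, ⟨y, hy⟩, p⟩ := t
  obtain ⟨E', ⟨y', hy'⟩, p'⟩ := t'
  cases h1
  cases h2
  cases h3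
  rfl

/-- The fibre of `𝒢_{∞,S}` over `v` as a `Π_v`-set (object of `Action (Type u) Π_v`).
[cite: MochizukiSemiAnbd2006, Prop 3.6 p.38] -/
def CovObj.fibVAction (v : 𝒢.graph.Vertex) : Action (Type u) (𝒢.Gv v) where
  V := S.FibV c v
  ρ :=
    { toFun := fun g => TypeCat.ofHom (S.fibVAct c v g)
      map_one' := by
        apply ConcreteCategory.hom_ext
        intro t
        refine CovObj.FibV.ext S c rfl ?_ HEq.rfl
        change (S.SV v).obj.ρ 1 t.2.1.1 = t.2.1.1
        rw [map_one]
        rfl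
      map_mul' := fun g g' => by
        apply ConcreteCategory.hom_ext
        intro t
        refine CovObj.FibV.ext S c rfl ?_ HEq.rfl
        change (S.SV v).obj.ρ (g * g') t.2.1.1 = (S.SV v).obj.ρ g ((S.SV v).obj.ρ g' t.2.1.1)
        rw [map_mul]
        rfl }

/-- The fibre of `𝒢_{∞,S}` over `e` as a `Π_e`-set. [cite: MochizukiSemiAnbd2006, Prop 3.6 p.38] -/
def CovObj.fibEAction (e : 𝒢.graph.Edge) : Action (Type u) (𝒢.Ge e) where
  V := S.FibE c e
  ρ :=
    { toFun := fun g => TypeCat.ofHom (S.fibEAct c e g)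
      map_one' := by
        apply ConcreteCategory.hom_ext
        intro t
        refine CovObj.FibE.ext S c rfl ?_ HEq.rfl
        change (S.SE e).obj.ρ 1 t.2.1.1 = t.2.1.1
        rw [map_one]
        rfl
      map_mul' := fun g g' => by
        apply ConcreteCategory.hom_ext
        intro t
        refine CovObj.FibE.ext S c rfl ?_ HEq.rfl
        change (S.SE e).obj.ρ (g * g') t.2.1.1 = (S.SE e).obj.ρ g ((S.SE e).obj.ρ g' t.2.1.1)
        rw [map_mul]
        rfl }

/-- The underlying semi-graph of a covering of a countable `𝒢` is countable.
[cite: MochizukiSemiAnbd2006, §3 p.37] -/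
theorem CovObj.orbitGraph_isCountable (h𝒢 : 𝒢.IsCountable) : S.orbitGraph.IsCountable := by
  haveI := h𝒢.countable_vertex
  haveI := h𝒢.countable_edge
  haveI : ∀ v, Countable (S.SV v).obj.V := fun v => (S.SV v).property.1
  haveI : ∀ e, Countable (S.SE e).obj.V := fun e => (S.SE e).property.1
  refine ⟨?_, ?_⟩
  · change Countable (Quot S.VRel)
    exact (Quot.mk_surjective).countable
  · change Countable (Quot S.ERel)
    exact (Quot.mk_surjective).countable

/-- For countable `𝒢`, the fibre of `𝒢_{∞,S}` over `v` is an object of `B^temp(Π_v)`: countable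
(countably many orbits, points and path classes) with open stabilisers (the stabiliser of
`(V, x, p)` is that of `x`). [cite: MochizukiSemiAnbd2006, Prop 3.6 p.38] -/
theorem CovObj.fibVAction_mem (h𝒢 : 𝒢.IsCountable) (v : 𝒢.graph.Vertex) :
    temperedAction (𝒢.Gv v) (S.fibVAction c v) := by
  refine ⟨?_, fun t => ?_⟩
  · haveI : Countable S.OVertex := (S.orbitGraph_isCountable h𝒢).countable_vertex
    haveI : ∀ V : S.OVertex,
        Countable (S.orbitGraph.basept c ⟶ S.orbitGraph.basept (Sum.inl V)) := fun V =>
      S.orbitGraph.countable_hom_fundamentalGroupoid (S.orbitGraph_isCountable h𝒢) c (Sum.inl V)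
    haveI : Countable (S.SV v).obj.V := (S.SV v).property.1
    change Countable (S.FibV c v)
    unfold CovObj.FibV
    infer_instance
  · have hx := (S.SV v).property.2 t.2.1.1
    have e : {g : 𝒢.Gv v | (S.fibVAction c v).ρ g t = t} =
        {g : 𝒢.Gv v | (S.SV v).obj.ρ g t.2.1.1 = t.2.1.1} :=
      Set.ext fun g => ⟨fun h => congrArg (fun s : S.FibV c v => s.2.1.1) h,
        fun h => CovObj.FibV.ext S c rfl h HEq.rfl⟩
    change IsOpen {g : 𝒢.Gv v | (S.fibVAction c v).ρ g t = t}
    rw [e]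
    exact hx

/-- The same for the fibre over an edge. [cite: MochizukiSemiAnbd2006, Prop 3.6 p.38] -/
theorem CovObj.fibEAction_mem (h𝒢 : 𝒢.IsCountable) (e : 𝒢.graph.Edge) :
    temperedAction (𝒢.Ge e) (S.fibEAction c e) := by
  refine ⟨?_, fun t => ?_⟩
  · haveI : Countable S.OEdge := (S.orbitGraph_isCountable h𝒢).countable_edge
    haveI : ∀ E : S.OEdge,
        Countable (S.orbitGraph.basept c ⟶ S.orbitGraph.basept (Sum.inr E)) := fun E =>
      S.orbitGraph.countable_hom_fundamentalGroupoid (S.orbitGraph_isCountable h𝒢) c (Sum.inr E)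
    haveI : Countable (S.SE e).obj.V := (S.SE e).property.1
    change Countable (S.FibE c e)
    unfold CovObj.FibE
    infer_instance
  · have hy := (S.SE e).property.2 t.2.1.1
    have h : {g : 𝒢.Ge e | (S.fibEAction c e).ρ g t = t} =
        {g : 𝒢.Ge e | (S.SE e).obj.ρ g t.2.1.1 = t.2.1.1} :=
      Set.ext fun g => ⟨fun h => congrArg (fun s : S.FibE c e => s.2.1.1) h,
        fun h => CovObj.FibE.ext S c rfl h HEq.rfl⟩
    change IsOpen {g : 𝒢.Ge e | (S.fibEAction c e).ρ g t = t}
    rw [h]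
    exact hy

/-- The fibre of `𝒢_{∞,S}` over `v` as an object of `B^temp(Π_v)`. [cite: MochizukiSemiAnbd2006, Prop 3.6 p.38] -/
def CovObj.fibV (h𝒢 : 𝒢.IsCountable) (v : 𝒢.graph.Vertex) : BTemp (𝒢.Gv v) :=
  ⟨S.fibVAction c v, S.fibVAction_mem c h𝒢 v⟩

/-- The fibre of `𝒢_{∞,S}` over `e` as an object of `B^temp(Π_e)`. [cite: MochizukiSemiAnbd2006, Prop 3.6 p.38] -/
def CovObj.fibE (h𝒢 : 𝒢.IsCountable) (e : 𝒢.graph.Edge) : BTemp (𝒢.Ge e) :=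
  ⟨S.fibEAction c e, S.fibEAction_mem c h𝒢 e⟩

end ProfiniteSemiGraph

end Literature.AnabelianGeometry.SemiGraphs
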